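import Summits.CriticalPhenomena.PercolationContinuityZ3.Theorems.PercNearOneGluingNoHeavyLowerTailCILStarTransfer
import Summits.CriticalPhenomena.PercolationContinuityZ3.Theorems.PercNearOneGluingNoHeavyLowerTailQuantitativeLonelierMember
import HarnessLib

/-!
# `NoHeavyLowerTail` (stmt-CriticalPhenomena-4575) — CIL at a general observer UP TO AN EXPLICIT DEFICIENCY
# ("weakly attached light Steiner neighbours are harmless")

Support file (prover `prim-hp-5`, hull-port cell, blob-quotient technique; `--supports stmt-CriticalPhenomena-4575`).
No definitions, no named facts, no sorries.

Notation as in `…CILStarTransfer`: `μ = prodBernoulli w`, relays `A`, observer `o ∉ A`, level `j`, `L = {1 ≤ N ≤ j}`,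
`R_q = {|π(q)| ≤ j}`, `x ~' y` = open path avoiding `o`, `s(y) = μ{|π'(y)| ≤ j}` the `H`-lightness (`H = G − o`), `σ_B` the
star event of `o`, `Γ` the positive-weight neighbours of `o`.

The star transfer (`CutObserver.star_transfer`, `Theorems.cil_of_starStability`) reduces CIL at `o` with witness `q` to
set-champion stability `CS(B, q)` in `G − o` for every star `B`; a star with a member `y` no lighter than `q`
(`s(y) ≤ s(q)`) is free by the lonely-cluster exchange.  The quantitative lonelier-member lemma
(`CutObserver.observerSet_le_add_posPart`, file `…QuantitativeLonelierMember`) says that for EVERY member `y` the stability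
inequality fails by at most `(s(y) − s(q))⁺`.  Carrying this slack through the star transfer gives:

* `CutObserver.star_transfer_add` — the one-star transfer with an additive slack `d`: `μ(L ∩ σ_B) ≤ μ(R_q ∩ σ_B) + μ(σ_B)·d`.
* `cil_add_starDeficiency` — **CIL up to a deficiency, every observer, every witness `q ≠ o`**: for any selector `f`
  picking a member `f B ∈ B` of each star,
  `μ(L) + μ(σ_∅)·s(q) ≤ μ(R_q) + Σ_{∅ ≠ B ⊆ Γ} μ(σ_B)·(s(f B) − s(q))⁺`.
  (The empty star carries `R_q` with mass `μ(σ_∅)·s(q)` and no mass of `L`.)  With `f B` = the member of `B` least light in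
  `G − o` this is `μ(R_q) − μ(L) ≥ μ(σ_∅)s(q) − E_σ[min_{y ∈ σ}(s(y) − s(q))⁺]`; for an observer all of whose neighbours are
  no lighter than `q` (relay neighbours of an `H`-champion, heavy Steiner neighbours) the deficiency vanishes (the landed
  relay-neighbour / heavy-Steiner theorems), and in general only stars made ENTIRELY of vertices lighter than `q` cost anything.
* `cil_of_weaklyAttachedLightNeighbours` — **corollary**: split `Γ` into `Good` (members with `s(y) ≤ s(q)`) and the rest, with
  `s(y) ≤ s(q) + D` on the rest (`D ≥ 0`).  If `D · μ(some open edge from o into Γ ∖ Good, none into Good) ≤ μ(σ_∅) · s(q)`, then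
  `μ(L) ≤ μ(R_q)` — CIL_j at `o` with witness `q` (for `q ∈ A` the conclusion of `stub_cumulativeIsolation` at this observer).
  E.g. with no good neighbour the condition reads `D·(1 − Π_{bad}(1 − w(o,y))) ≤ Π_{bad}(1 − w(o,y))·s(q)`.
-/

noncomputable section

namespace Summit.CriticalPhenomena.PercolationContinuityZ3.Theorems

open MeasureTheory Set Literature.Probability.LatticeModels Literature.Probability.Percolation
open scoped Classical BigOperators

variable {n : ℕ}

namespace CutObserver

/-- **Star transfer with a deficiency (one star).**  As `CutObserver.star_transfer`, but the set-champion stability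
inequality in `G − o` is only assumed up to an additive slack `d`:
`μ(q ≁' B, 1 ≤ |π'(B)| ≤ j) ≤ μ(q ≁' B, |π'(q)| ≤ j) + d` gives `μ(L ∩ σ_B) ≤ μ(R_q ∩ σ_B) + μ(σ_B)·d`
(independence of the star from the configuration off `o`).  Proof = the proof of `star_transfer` verbatim with the slack carried along. [folklore] -/
theorem star_transfer_add (w : Sym2 (Fin n) → unitInterval) (A : Finset (Fin n)) (o q : Fin n) (j : ℕ)
    (hoA : o ∉ A) (hqo : q ≠ o) (B : Finset (Fin n)) (hBo : ∀ y ∈ B, y ≠ o) (d : ℝ)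
    (hCS : (prodBernoulli w).real {ω : BondConfig (Fin n) |
        (∀ y ∈ B, ¬ (openGraph (ω ∩ {e | o ∉ e})).Reachable q y) ∧
          1 ≤ (A.filter fun z => ∃ y ∈ B, (openGraph (ω ∩ {e | o ∉ e})).Reachable y z).card ∧
          (A.filter fun z => ∃ y ∈ B, (openGraph (ω ∩ {e | o ∉ e})).Reachable y z).card ≤ j} ≤
      (prodBernoulli w).real {ω : BondConfig (Fin n) |
        (∀ y ∈ B, ¬ (openGraph (ω ∩ {e | o ∉ e})).Reachable q y) ∧
          (A.filter fun z => (openGraph (ω ∩ {e | o ∉ e})).Reachable q z).card ≤ j} + d) :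
    (prodBernoulli w).real ({ω : BondConfig (Fin n) |
        1 ≤ (A.filter fun x => ω ∈ openConn o x).card ∧ (A.filter fun x => ω ∈ openConn o x).card ≤ j} ∩
        starEvent o ↑B) ≤
      (prodBernoulli w).real ({ω : BondConfig (Fin n) | (A.filter fun x => ω ∈ openConn q x).card ≤ j} ∩
        starEvent o ↑B) + (prodBernoulli w).real (starEvent o ↑B) * d := by
  haveI : IsProbabilityMeasure (prodBernoulli w) := inferInstance
  set μ := prodBernoulli w with hμ
  set R' : BondConfig (Fin n) → Fin n → Fin n → Prop := fun ω x y =>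
    (openGraph (ω ∩ {e | o ∉ e})).Reachable x y with hR'
  set L := {ω : BondConfig (Fin n) |
    1 ≤ (A.filter fun x => ω ∈ openConn o x).card ∧ (A.filter fun x => ω ∈ openConn o x).card ≤ j} with hL
  set Rq := {ω : BondConfig (Fin n) | (A.filter fun x => ω ∈ openConn q x).card ≤ j} with hRq
  set σ := starEvent o (↑B : Set (Fin n)) with hσdef
  set V := {ω : BondConfig (Fin n) | (openGraph ω).Reachable q o} with hV
  -- the two `H`-events, written as events of `ω ∩ {e | o ∉ e}`
  set PL : BondConfig (Fin n) → Prop := fun ξ =>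
    (∀ y ∈ B, ¬ (openGraph ξ).Reachable q y) ∧
      1 ≤ (A.filter fun z => ∃ y ∈ B, (openGraph ξ).Reachable y z).card ∧
      (A.filter fun z => ∃ y ∈ B, (openGraph ξ).Reachable y z).card ≤ j with hPL
  set PR : BondConfig (Fin n) → Prop := fun ξ =>
    (∀ y ∈ B, ¬ (openGraph ξ).Reachable q y) ∧ (A.filter fun z => (openGraph ξ).Reachable q z).card ≤ j
    with hPR
  set CSL := {ω : BondConfig (Fin n) | PL (ω ∩ {e | o ∉ e})} with hCSL
  set CSR := {ω : BondConfig (Fin n) | PR (ω ∩ {e | o ∉ e})} with hCSR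
  have hkey : μ.real CSL ≤ μ.real CSR + d := hCS
  -- (F3) on σ: π(o) = π'(B)
  have hF3 : ∀ ω ∈ σ, (A.filter fun x => ω ∈ openConn o x) =
      (A.filter fun z => ∃ y ∈ B, R' ω y z) := by
    intro ω hω
    refine Finset.filter_congr fun x hx => ⟨fun h => ?_, fun h => ?_⟩
    · have hxo : x ≠ o := fun h' => hoA (h' ▸ hx)
      obtain ⟨y, hy, hyx⟩ := exists_avoid_of_reachable_star hω hxo h
      exact ⟨y, Finset.mem_coe.1 hy, hyx⟩
    · obtain ⟨y, hy, hyx⟩ := h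
      exact reachable_of_mem_star hω (hBo y hy) (Finset.mem_coe.2 hy) hyx
  -- (F4) off V: π(q) = π'(q) and q ≁' B
  have hF4a : ∀ ω, ω ∉ V → (A.filter fun x => ω ∈ openConn q x) = (A.filter fun z => R' ω q z) := by
    intro ω hVω
    refine Finset.filter_congr fun x _ => ⟨fun h => ?_, fun h => reachable_mono inter_subset_left h⟩
    exact reachable_avoiding_of_not_reachable hVω h
  have hF4b : ∀ ω ∈ σ, ω ∉ V → ∀ y ∈ B, ¬ R' ω q y := by
    intro ω hω hVω y hy hqy
    exact hVω ((reachable_of_mem_star hω (hBo y hy) (Finset.mem_coe.2 hy) hqy.symm).symm)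
  -- (F5) on σ: q ≁' B ⇒ q ≁ o
  have hF5 : ∀ ω ∈ σ, (∀ y ∈ B, ¬ R' ω q y) → ω ∉ V := by
    intro ω hω hny hVω
    obtain ⟨y, hy, hyq⟩ := exists_avoid_of_reachable_star hω hqo (SimpleGraph.Reachable.symm hVω)
    exact hny y (Finset.mem_coe.1 hy) hyq.symm
  -- (a) L ∩ σ ∩ V ⊆ Rq ∩ σ ∩ V
  have ha : L ∩ σ ∩ V ⊆ Rq ∩ σ ∩ V := by
    rintro ω ⟨⟨hLω, hω⟩, hVω⟩
    refine ⟨⟨?_, hω⟩, hVω⟩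
    show (A.filter fun x => ω ∈ openConn q x).card ≤ j
    have heq : (A.filter fun x => ω ∈ openConn q x) = (A.filter fun x => ω ∈ openConn o x) :=
      Finset.filter_congr fun x _ => ⟨fun h => (SimpleGraph.Reachable.symm hVω).trans h, fun h => hVω.trans h⟩
    rw [heq]; exact hLω.2
  -- (b) (L ∩ σ) \ V ⊆ σ ∩ CSL
  have hb : (L ∩ σ) \ V ⊆ σ ∩ CSL := by
    rintro ω ⟨⟨hLω, hω⟩, hVω⟩
    refine ⟨hω, ?_⟩
    show PL (ω ∩ {e | o ∉ e})
    refine ⟨hF4b ω hω hVω, ?_, ?_⟩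
    · have := hLω.1; rw [hF3 ω hω] at this; exact this
    · have := hLω.2; rw [hF3 ω hω] at this; exact this
  -- (c) σ ∩ CSR ⊆ (Rq ∩ σ) \ V
  have hc : σ ∩ CSR ⊆ (Rq ∩ σ) \ V := by
    rintro ω ⟨hω, hRω⟩
    change PR (ω ∩ {e | o ∉ e}) at hRω
    obtain ⟨hny, hcard⟩ := hRω
    have hVω : ω ∉ V := hF5 ω hω hny
    refine ⟨⟨?_, hω⟩, hVω⟩
    show (A.filter fun x => ω ∈ openConn q x).card ≤ j
    rw [hF4a ω hVω]; exact hcard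
  -- (d) independence
  have hdL : μ.real (σ ∩ CSL) = μ.real σ * μ.real CSL := measureReal_starEvent_inter_avoid w o ↑B PL
  have hdR : μ.real (σ ∩ CSR) = μ.real σ * μ.real CSR := measureReal_starEvent_inter_avoid w o ↑B PR
  -- assemble
  have hsplitL := measureReal_inter_add_sdiff (μ := μ) (s := L ∩ σ) (MeasurableSet.of_discrete (s := V))
    (measure_ne_top _ _)
  have hsplitR := measureReal_inter_add_sdiff (μ := μ) (s := Rq ∩ σ) (MeasurableSet.of_discrete (s := V))
    (measure_ne_top _ _)
  have h1 : μ.real (L ∩ σ ∩ V) ≤ μ.real (Rq ∩ σ ∩ V) := measureReal_mono ha (measure_ne_top _ _)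
  have h2 : μ.real ((L ∩ σ) \ V) ≤ μ.real (σ ∩ CSL) := measureReal_mono hb (measure_ne_top _ _)
  have h3 : μ.real (σ ∩ CSL) ≤ μ.real (σ ∩ CSR) + μ.real σ * d := by
    rw [hdL, hdR]
    have := mul_le_mul_of_nonneg_left hkey (measureReal_nonneg (μ := μ) (s := σ))
    linarith [this, mul_add (μ.real σ) (μ.real CSR) d]
  have h4 : μ.real (σ ∩ CSR) ≤ μ.real ((Rq ∩ σ) \ V) := measureReal_mono hc (measure_ne_top _ _)
  calc μ.real (L ∩ σ) = μ.real (L ∩ σ ∩ V) + μ.real ((L ∩ σ) \ V) := hsplitL.symm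
    _ ≤ μ.real (Rq ∩ σ ∩ V) + μ.real ((Rq ∩ σ) \ V) + μ.real σ * d := by linarith
    _ = μ.real (Rq ∩ σ) + μ.real σ * d := by rw [hsplitR]

end CutObserver

open CutObserver KNPreFKG in
/-- **CIL up to the star deficiency (every observer, every witness).**  Let `o ∉ A`, `q ≠ o`, `Γ` the set of
positive-weight neighbours of `o`, `s(y) = μ{|π'(y)| ≤ j}` the lightness in `G − o`, and `f` any selector with `f B ∈ B` for
nonempty `B ⊆ Γ`.  Then
`μ{1 ≤ N ≤ j} + μ(σ_∅)·s(q) ≤ μ{|π(q)| ≤ j} + Σ_{∅ ≠ B ⊆ Γ} μ(σ_B)·max (s(f B) − s(q)) 0`.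
Proof: star decomposition (`KNPreFKG.real_eq_sum_inter_starEvent`); the empty star carries `R_q` with mass `μ(σ_∅)s(q)`
(independence) and none of `L`; every other star is transferred by `star_transfer_add` with the slack of
`CutObserver.observerSet_le_add_posPart` at the member `f B`, read in the configuration off `o`
(`measureReal_preimage_avoid`). [cite: VandenbergHaggstromKahn2005, Thm. 1.5 (p. 7); KozmaNitzan2024, Lemma 5 (pp. 13–14) — star decomposition] -/
theorem cil_add_starDeficiency (w : Sym2 (Fin n) → unitInterval) (A : Finset (Fin n)) (o q : Fin n) (j : ℕ)
    (hoA : o ∉ A) (hqo : q ≠ o) (f : Finset (Fin n) → Fin n)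
    (hf : ∀ B : Finset (Fin n), B.Nonempty → B ⊆ (Finset.univ.filter fun v => v ≠ o ∧ w s(o, v) ≠ 0) → f B ∈ B) :
    (prodBernoulli w).real {ω : BondConfig (Fin n) |
        1 ≤ (A.filter fun x => ω ∈ openConn o x).card ∧ (A.filter fun x => ω ∈ openConn o x).card ≤ j} +
      (prodBernoulli w).real (starEvent o (∅ : Set (Fin n))) *
        (prodBernoulli w).real {ω : BondConfig (Fin n) |
          (A.filter fun z => (openGraph (ω ∩ {e | o ∉ e})).Reachable q z).card ≤ j} ≤
    (prodBernoulli w).real {ω : BondConfig (Fin n) | (A.filter fun x => ω ∈ openConn q x).card ≤ j} +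
      ∑ B ∈ (Finset.univ.filter fun v => v ≠ o ∧ w s(o, v) ≠ 0).powerset.erase ∅,
        (prodBernoulli w).real (starEvent o (↑B : Set (Fin n))) *
          max ((prodBernoulli w).real {ω : BondConfig (Fin n) |
              (A.filter fun z => (openGraph (ω ∩ {e | o ∉ e})).Reachable (f B) z).card ≤ j} -
            (prodBernoulli w).real {ω : BondConfig (Fin n) |
              (A.filter fun z => (openGraph (ω ∩ {e | o ∉ e})).Reachable q z).card ≤ j}) 0 := by
  haveI : IsProbabilityMeasure (prodBernoulli w) := inferInstance
  set μ := prodBernoulli w with hμ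
  set L := {ω : BondConfig (Fin n) |
    1 ≤ (A.filter fun x => ω ∈ openConn o x).card ∧ (A.filter fun x => ω ∈ openConn o x).card ≤ j} with hL
  set Rq := {ω : BondConfig (Fin n) | (A.filter fun x => ω ∈ openConn q x).card ≤ j} with hRq
  set sW : Fin n → ℝ := fun y => μ.real {ω : BondConfig (Fin n) |
    (A.filter fun z => (openGraph (ω ∩ {e | o ∉ e})).Reachable y z).card ≤ j} with hsW
  set Γ : Finset (Fin n) := Finset.univ.filter fun v => v ≠ o ∧ w s(o, v) ≠ 0 with hΓ
  change μ.real L + μ.real (starEvent o (∅ : Set (Fin n))) * sW q ≤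
    μ.real Rq + ∑ B ∈ Γ.powerset.erase ∅, μ.real (starEvent o (↑B : Set (Fin n))) * max (sW (f B) - sW q) 0
  have hΓo : o ∉ Γ := by
    rw [hΓ, Finset.mem_filter]; exact fun h => h.2.1 rfl
  have hiso : ∀ v, v ≠ o → v ∉ Γ → w s(o, v) = 0 := by
    intro v hvo hvΓ
    by_contra hne
    exact hvΓ (Finset.mem_filter.2 ⟨Finset.mem_univ _, hvo, hne⟩)
  have hdecL := real_eq_sum_inter_starEvent w Γ o hΓo hiso L
  have hdecR := real_eq_sum_inter_starEvent w Γ o hΓo hiso Rq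
  have h0mem : (∅ : Finset (Fin n)) ∈ Γ.powerset := Finset.empty_mem_powerset Γ
  rw [← Finset.add_sum_erase _ _ h0mem] at hdecL hdecR
  -- the empty star: no mass of `L`, and `R_q` factorises
  have hL0 : μ.real (L ∩ starEvent o ↑(∅ : Finset (Fin n))) = 0 := by
    have h0 : L ∩ starEvent o ↑(∅ : Finset (Fin n)) = (∅ : Set (BondConfig (Fin n))) := by
      ext ω
      simp only [mem_inter_iff, mem_empty_iff_false, iff_false, not_and]
      intro hLω hσ
      rw [Finset.coe_empty] at hσ
      obtain ⟨x, hx⟩ := Finset.card_pos.1 (lt_of_lt_of_le Nat.zero_lt_one hLω.1)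
      rw [Finset.mem_filter] at hx
      exact not_reachable_of_mem_starEvent_empty hσ (fun h => hoA (h ▸ hx.1)) hx.2
    rw [h0, measureReal_empty]
  have hR0 : μ.real (Rq ∩ starEvent o ↑(∅ : Finset (Fin n))) = μ.real (starEvent o (∅ : Set (Fin n))) * sW q := by
    -- on `σ_∅` the witness is not joined to `o`, so `π(q) = π'(q)`
    set PR : BondConfig (Fin n) → Prop := fun ξ => (A.filter fun z => (openGraph ξ).Reachable q z).card ≤ j with hPR
    have he : Rq ∩ starEvent o ↑(∅ : Finset (Fin n)) =
        starEvent o (∅ : Set (Fin n)) ∩ {ω | PR (ω ∩ {e | o ∉ e})} := by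
      rw [Finset.coe_empty]
      ext ω
      simp only [mem_inter_iff, mem_setOf_eq, hRq, hPR]
      constructor
      · rintro ⟨hR, hσ⟩
        refine ⟨hσ, ?_⟩
        have hqo' : ¬ (openGraph ω).Reachable q o := by
          intro h
          obtain ⟨y, hy, _⟩ := exists_avoid_of_reachable_star hσ hqo h.symm
          exact hy
        have heq : (A.filter fun x => ω ∈ openConn q x) = (A.filter fun z => (openGraph (ω ∩ {e | o ∉ e})).Reachable q z) :=
          Finset.filter_congr fun x _ =>
            ⟨fun h => reachable_avoiding_of_not_reachable hqo' h, fun h => reachable_mono inter_subset_left h⟩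
        rw [← heq]; exact hR
      · rintro ⟨hσ, hR⟩
        refine ⟨?_, hσ⟩
        have hqo' : ¬ (openGraph ω).Reachable q o := by
          intro h
          obtain ⟨y, hy, _⟩ := exists_avoid_of_reachable_star hσ hqo h.symm
          exact hy
        have heq : (A.filter fun x => ω ∈ openConn q x) = (A.filter fun z => (openGraph (ω ∩ {e | o ∉ e})).Reachable q z) :=
          Finset.filter_congr fun x _ =>
            ⟨fun h => reachable_avoiding_of_not_reachable hqo' h, fun h => reachable_mono inter_subset_left h⟩
        rw [heq]; exact hR
    rw [he, measureReal_starEvent_inter_avoid w o (∅ : Set (Fin n)) PR]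
  -- the nonempty stars: transfer with the QLM slack
  have hstar : ∀ B ∈ Γ.powerset.erase ∅,
      μ.real (L ∩ starEvent o ↑B) ≤ μ.real (Rq ∩ starEvent o ↑B) +
        μ.real (starEvent o (↑B : Set (Fin n))) * max (sW (f B) - sW q) 0 := by
    intro B hB
    have hBne : B.Nonempty := Finset.nonempty_iff_ne_empty.2 (Finset.ne_of_mem_erase hB)
    have hBΓ : B ⊆ Γ := Finset.mem_powerset.1 (Finset.mem_of_mem_erase hB)
    have hBo : ∀ y ∈ B, y ≠ o := fun y hy => (Finset.mem_filter.1 (hBΓ hy)).2.1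
    have hfB : f B ∈ B := hf B hBne hBΓ
    refine star_transfer_add w A o q j hoA hqo B hBo (max (sW (f B) - sW q) 0) ?_
    -- the quantitative lonelier-member lemma in the graph without the edges at `o`
    have key := observerSet_le_add_posPart (fun e => if e ∈ {e : Sym2 (Fin n) | o ∉ e} then w e else 0)
      A B (f B) q hfB j
    have e1 : ∀ x : Fin n, {ω : BondConfig (Fin n) |
          (A.filter fun z => (openGraph (ω ∩ {e | o ∉ e})).Reachable x z).card ≤ j} =
        {ω : BondConfig (Fin n) | ω ∩ {e | o ∉ e} ∈
          {ξ : BondConfig (Fin n) | (A.filter fun z => ξ ∈ openConn x z).card ≤ j}} := by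
      intro x; ext ω; simp only [mem_setOf_eq, filter_avoid_eq]
    have e2 : {ω : BondConfig (Fin n) |
          (∀ y ∈ B, ¬ (openGraph (ω ∩ {e | o ∉ e})).Reachable q y) ∧
            1 ≤ (A.filter fun z => ∃ y ∈ B, (openGraph (ω ∩ {e | o ∉ e})).Reachable y z).card ∧
            (A.filter fun z => ∃ y ∈ B, (openGraph (ω ∩ {e | o ∉ e})).Reachable y z).card ≤ j} =
        {ω : BondConfig (Fin n) | ω ∩ {e | o ∉ e} ∈
          {ξ : BondConfig (Fin n) | (∀ x ∈ B, ξ ∉ openConn q x) ∧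
            1 ≤ (A.filter fun z => ∃ x ∈ B, ξ ∈ openConn x z).card ∧
            (A.filter fun z => ∃ x ∈ B, ξ ∈ openConn x z).card ≤ j}} := by
      ext ω; simp only [mem_setOf_eq, filter_avoid_exists_eq]; exact Iff.rfl
    have e3 : {ω : BondConfig (Fin n) |
          (∀ y ∈ B, ¬ (openGraph (ω ∩ {e | o ∉ e})).Reachable q y) ∧
            (A.filter fun z => (openGraph (ω ∩ {e | o ∉ e})).Reachable q z).card ≤ j} =
        {ω : BondConfig (Fin n) | ω ∩ {e | o ∉ e} ∈
          {ξ : BondConfig (Fin n) | (∀ x ∈ B, ξ ∉ openConn q x) ∧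
            (A.filter fun z => ξ ∈ openConn q z).card ≤ j}} := by
      ext ω; simp only [mem_setOf_eq, filter_avoid_eq]; exact Iff.rfl
    have hsf : sW (f B) = (prodBernoulli fun e => if e ∈ {e : Sym2 (Fin n) | o ∉ e} then w e else 0).real
        {ξ : BondConfig (Fin n) | (A.filter fun z => ξ ∈ openConn (f B) z).card ≤ j} := by
      simp only [hsW]; rw [e1 (f B), measureReal_preimage_avoid]
    have hsq : sW q = (prodBernoulli fun e => if e ∈ {e : Sym2 (Fin n) | o ∉ e} then w e else 0).real
        {ξ : BondConfig (Fin n) | (A.filter fun z => ξ ∈ openConn q z).card ≤ j} := by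
      simp only [hsW]; rw [e1 q, measureReal_preimage_avoid]
    rw [e2, e3, measureReal_preimage_avoid, measureReal_preimage_avoid, hsf, hsq]
    convert key using 3
  -- assemble
  have hsum := Finset.sum_le_sum hstar
  rw [Finset.sum_add_distrib] at hsum
  rw [hdecL, hdecR, hL0, hR0]
  linarith [hsum]

open CutObserver KNPreFKG in
/-- **CIL with weakly attached light neighbours.**  Let `o ∉ A`, `q ≠ o`, `s(y) = μ{|π'(y)| ≤ j}` the lightness in
`G − o`.  Let `Good` be a set of vertices no lighter than `q` (`s(y) ≤ s(q)` on `Good`), and suppose every other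
positive-weight neighbour `y` of `o` satisfies `s(y) ≤ s(q) + D` (`D ≥ 0`).  If
`D · μ(some open edge from o to a positive-weight neighbour outside Good, and no open edge from o into Good) ≤ μ(σ_∅) · s(q)`
(`σ_∅` = no open edge at `o` towards a vertex `≠ o`), then `μ{1 ≤ N ≤ j} ≤ μ{|π(q)| ≤ j}` — CIL_j at `o` with the witness `q`
(for `q ∈ A`: the conclusion of `stub_cumulativeIsolation` at this observer).  With `Good ⊇` all neighbours this is
`Theorems.cil_of_starStability`'s free case (relay-neighboured `H`-champion, heavy Steiner neighbours); in general it says that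
LIGHT non-relay neighbours cost nothing as long as their total attachment is small against `s(q)/D`.
[cite: VandenbergHaggstromKahn2005, Thm. 1.5 (p. 7); KozmaNitzan2024, Lemma 5 (pp. 13–14) — star decomposition] -/
theorem cil_of_weaklyAttachedLightNeighbours (w : Sym2 (Fin n) → unitInterval) (A : Finset (Fin n)) (o q : Fin n)
    (j : ℕ) (hoA : o ∉ A) (hqo : q ≠ o) (Good : Finset (Fin n)) (D : ℝ) (hD : 0 ≤ D)
    (hgood : ∀ y ∈ Good,
      (prodBernoulli w).real {ω : BondConfig (Fin n) |
          (A.filter fun z => (openGraph (ω ∩ {e | o ∉ e})).Reachable y z).card ≤ j} ≤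
        (prodBernoulli w).real {ω : BondConfig (Fin n) |
          (A.filter fun z => (openGraph (ω ∩ {e | o ∉ e})).Reachable q z).card ≤ j})
    (hgap : ∀ y : Fin n, y ≠ o → w s(o, y) ≠ 0 → y ∉ Good →
      (prodBernoulli w).real {ω : BondConfig (Fin n) |
          (A.filter fun z => (openGraph (ω ∩ {e | o ∉ e})).Reachable y z).card ≤ j} ≤
        (prodBernoulli w).real {ω : BondConfig (Fin n) |
          (A.filter fun z => (openGraph (ω ∩ {e | o ∉ e})).Reachable q z).card ≤ j} + D)
    (hsmall : D * (prodBernoulli w).real {ω : BondConfig (Fin n) |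
        (∃ y : Fin n, y ≠ o ∧ w s(o, y) ≠ 0 ∧ y ∉ Good ∧ s(o, y) ∈ ω) ∧ ∀ y ∈ Good, y ≠ o → s(o, y) ∉ ω} ≤
      (prodBernoulli w).real (starEvent o (∅ : Set (Fin n))) *
        (prodBernoulli w).real {ω : BondConfig (Fin n) |
          (A.filter fun z => (openGraph (ω ∩ {e | o ∉ e})).Reachable q z).card ≤ j}) :
    (prodBernoulli w).real {ω : BondConfig (Fin n) |
        1 ≤ (A.filter fun x => ω ∈ openConn o x).card ∧ (A.filter fun x => ω ∈ openConn o x).card ≤ j} ≤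
      (prodBernoulli w).real {ω : BondConfig (Fin n) | (A.filter fun x => ω ∈ openConn q x).card ≤ j} := by
  haveI : IsProbabilityMeasure (prodBernoulli w) := inferInstance
  set μ := prodBernoulli w with hμ
  set L := {ω : BondConfig (Fin n) |
    1 ≤ (A.filter fun x => ω ∈ openConn o x).card ∧ (A.filter fun x => ω ∈ openConn o x).card ≤ j} with hL
  set Rq := {ω : BondConfig (Fin n) | (A.filter fun x => ω ∈ openConn q x).card ≤ j} with hRq
  set sW : Fin n → ℝ := fun y => μ.real {ω : BondConfig (Fin n) |
    (A.filter fun z => (openGraph (ω ∩ {e | o ∉ e})).Reachable y z).card ≤ j} with hsW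
  set Γ : Finset (Fin n) := Finset.univ.filter fun v => v ≠ o ∧ w s(o, v) ≠ 0 with hΓ
  set E := {ω : BondConfig (Fin n) |
    (∃ y : Fin n, y ≠ o ∧ w s(o, y) ≠ 0 ∧ y ∉ Good ∧ s(o, y) ∈ ω) ∧ ∀ y ∈ Good, y ≠ o → s(o, y) ∉ ω} with hE
  change D * μ.real E ≤ μ.real (starEvent o (∅ : Set (Fin n))) * sW q at hsmall
  change ∀ y ∈ Good, sW y ≤ sW q at hgood
  change ∀ y : Fin n, y ≠ o → w s(o, y) ≠ 0 → y ∉ Good → sW y ≤ sW q + D at hgap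
  -- the selector: a good member if there is one, else any member
  set f : Finset (Fin n) → Fin n := fun B =>
    if h : (B ∩ Good).Nonempty then h.choose else if h' : B.Nonempty then h'.choose else o with hf
  have hfmem : ∀ B : Finset (Fin n), B.Nonempty → f B ∈ B := by
    intro B hB
    simp only [hf]
    by_cases h : (B ∩ Good).Nonempty
    · rw [dif_pos h]; exact (Finset.mem_inter.1 h.choose_spec).1
    · rw [dif_neg h, dif_pos hB]; exact hB.choose_spec
  have hfgood : ∀ B : Finset (Fin n), (B ∩ Good).Nonempty → f B ∈ Good := by
    intro B h
    simp only [hf]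
    rw [dif_pos h]; exact (Finset.mem_inter.1 h.choose_spec).2
  have hmain := cil_add_starDeficiency w A o q j hoA hqo f (fun B hB _ => hfmem B hB)
  change μ.real L + μ.real (starEvent o (∅ : Set (Fin n))) * sW q ≤
    μ.real Rq + ∑ B ∈ Γ.powerset.erase ∅, μ.real (starEvent o (↑B : Set (Fin n))) * max (sW (f B) - sW q) 0 at hmain
  have hΓo : o ∉ Γ := by
    rw [hΓ, Finset.mem_filter]; exact fun h => h.2.1 rfl
  have hiso : ∀ v, v ≠ o → v ∉ Γ → w s(o, v) = 0 := by
    intro v hvo hvΓ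
    by_contra hne
    exact hvΓ (Finset.mem_filter.2 ⟨Finset.mem_univ _, hvo, hne⟩)
  -- termwise: the slack of a star is `0` if it has a good member, else `≤ D`, and then the star lies in `E`
  have hterm : ∀ B ∈ Γ.powerset.erase ∅,
      μ.real (starEvent o (↑B : Set (Fin n))) * max (sW (f B) - sW q) 0 ≤
        D * μ.real (E ∩ starEvent o (↑B : Set (Fin n))) := by
    intro B hB
    have hBne : B.Nonempty := Finset.nonempty_iff_ne_empty.2 (Finset.ne_of_mem_erase hB)
    have hBΓ : B ⊆ Γ := Finset.mem_powerset.1 (Finset.mem_of_mem_erase hB)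
    by_cases h : (B ∩ Good).Nonempty
    · have h0 : max (sW (f B) - sW q) 0 = 0 :=
        max_eq_right (by linarith [hgood (f B) (hfgood B h)])
      rw [h0, mul_zero]
      exact mul_nonneg hD measureReal_nonneg
    · have hfB : f B ∈ B := hfmem B hBne
      have hfΓ := Finset.mem_filter.1 (hBΓ hfB)
      have hfng : f B ∉ Good := fun hg => h ⟨f B, Finset.mem_inter.2 ⟨hfB, hg⟩⟩
      have hle : max (sW (f B) - sW q) 0 ≤ D :=
        max_le (by linarith [hgap (f B) hfΓ.2.1 hfΓ.2.2 hfng]) hD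
      have hsub : starEvent o (↑B : Set (Fin n)) ⊆ E := by
        intro ω hω
        have hiff := (mem_starEvent_iff o (↑B : Set (Fin n)) ω).1 hω
        obtain ⟨y, hy⟩ := hBne
        have hyΓ := Finset.mem_filter.1 (hBΓ hy)
        refine ⟨⟨y, hyΓ.2.1, hyΓ.2.2, fun hg => h ⟨y, Finset.mem_inter.2 ⟨hy, hg⟩⟩, ?_⟩, ?_⟩
        · exact (hiff y hyΓ.2.1).2 (Finset.mem_coe.2 hy)
        · intro g hg hgo hog
          have hgB : g ∈ B := Finset.mem_coe.1 ((hiff g hgo).1 hog)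
          exact h ⟨g, Finset.mem_inter.2 ⟨hgB, hg⟩⟩
      have heq : E ∩ starEvent o (↑B : Set (Fin n)) = starEvent o (↑B : Set (Fin n)) :=
        inter_eq_right.2 hsub
      rw [heq]
      have := mul_le_mul_of_nonneg_left hle (measureReal_nonneg (μ := μ) (s := starEvent o (↑B : Set (Fin n))))
      linarith [this]
  have hsum := Finset.sum_le_sum hterm
  rw [← Finset.mul_sum] at hsum
  -- `Σ_{B ≠ ∅} μ(E ∩ σ_B) ≤ μ(E)`
  have hdecE := real_eq_sum_inter_starEvent w Γ o hΓo hiso E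
  have h0mem : (∅ : Finset (Fin n)) ∈ Γ.powerset := Finset.empty_mem_powerset Γ
  rw [← Finset.add_sum_erase _ _ h0mem] at hdecE
  have hE : ∑ B ∈ Γ.powerset.erase ∅, μ.real (E ∩ starEvent o (↑B : Set (Fin n))) ≤ μ.real E := by
    rw [hdecE]
    linarith [measureReal_nonneg (μ := μ) (s := E ∩ starEvent o ↑(∅ : Finset (Fin n)))]
  have hE' := mul_le_mul_of_nonneg_left hE hD
  linarith [hmain, hsum, hE', hsmall]

end Summit.CriticalPhenomena.PercolationContinuityZ3.Theorems

end
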